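import Summits.KontsevichZagierPeriods.KontsevichZagierPeriods.Theorems.FermatIsogenyDeepWordSectorBP1

/-! # `FermatIsogenyDeepWordSectorBP2` — part 2/6 of the mechanical ≤400-line split of `B_src.lean` (sha256 9cb321caf3c881c0…)
Source: decomp-kz lens-5 g22 DeepWordSectorB.lean v4 @d2f1e37a (levels 3/4 closed hypothesis-free, Dirichlet move proved, level 6 from the linear rung; critic CLEARED g7-5 l.1397 / g7-7 l.1406); --supports stmt-KontsevichZagierPeriods-3898.
Split by census-1 g10 `gen/splitlean.py`: scopes re-opened with their `open`/`variable`/`set_option` context; mathematics and declaration order unchanged. -/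

noncomputable section
namespace Summit.KontsevichZagierPeriods.FermatIsogeny.DeepTargets
open Literature.NumberTheory.Transcendental MeasureTheory
open Summit.KontsevichZagierPeriods.KontsevichZagierPeriods.Theses.FermatIsogeny (BetaLinearSector BetaProductSector FermatSectorComplete)
section LevelThreeChains

/-- **LEVEL-3 CHAINS FROM ONE MOVE**: `BetaDirichletMove → BoxChain k 3 (SameType 3)` for every word length `k`. [this node] -/
theorem boxChain_three_of_dirichlet (hD : BetaDirichletMove) (k : ℕ) : BoxChain k 3 (SameType 3) := by
  intro u v u' v' hT q hq r r' hr hi hr' hi' hv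
  have h3 : (0:ℕ) < 3 := by norm_num
  have hab : ∀ j, 0 < lvl 3 u j ∧ 0 < lvl 3 v j := fun j => ⟨(lvl_bounds h3 u j).1, (lvl_bounds h3 v j).1⟩
  have hab' : ∀ j, 0 < lvl 3 u' j ∧ 0 < lvl 3 v' j := fun j => ⟨(lvl_bounds h3 u' j).1, (lvl_bounds h3 v' j).1⟩
  obtain ⟨hxz, hyz⟩ := (sameType_three_iff u v u' v').mp hT
  -- values
  have vX : 0 < bval (1/3) (2/3) := bval_pos (by norm_num) (by norm_num)
  have vY : 0 < bval (1/3) (1/3) := bval_pos (by norm_num) (by norm_num)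
  have vZ : 0 < bval (2/3) (2/3) := bval_pos (by norm_num) (by norm_num)
  have vr : r.value = (cstW3 u v : ℝ) * bval (1/3) (2/3) ^ xCount3 u v * bval (1/3) (1/3) ^ yCount3 u v
      * bval (2/3) (2/3) ^ zCount3 u v := by
    rw [word_value _ _ hab r hr hi, prod_bval_three]
  have vr' : r'.value = q * ((cstW3 u' v' : ℝ) * bval (1/3) (2/3) ^ xCount3 u' v' * bval (1/3) (1/3) ^ yCount3 u' v'
      * bval (2/3) (2/3) ^ zCount3 u' v') := by
    rw [word_value_const q hq _ _ hab' r' hr' hi', prod_bval_three]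
  have hWv : (3:ℝ) ^ zCount3 u' v' * (bval (1/3) (2/3) ^ xCount3 u v * bval (1/3) (1/3) ^ yCount3 u v
        * bval (2/3) (2/3) ^ zCount3 u v)
      = (3:ℝ) ^ zCount3 u v * (bval (1/3) (2/3) ^ xCount3 u' v' * bval (1/3) (1/3) ^ yCount3 u' v'
        * bval (2/3) (2/3) ^ zCount3 u' v') :=
    nf3 (dirichlet_rel_values hD) hxz hyz
  have hW0 : (3:ℝ) ^ zCount3 u' v' * (bval (1/3) (2/3) ^ xCount3 u v * bval (1/3) (1/3) ^ yCount3 u v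
        * bval (2/3) (2/3) ^ zCount3 u v) ≠ 0 := by positivity
  -- the constants: c·3^{z} = q·c'·3^{z'}
  have key : (cstW3 u v : ℝ) * 3 ^ zCount3 u v = q * cstW3 u' v' * 3 ^ zCount3 u' v' := by
    have e : (cstW3 u v : ℝ) * (bval (1/3) (2/3) ^ xCount3 u v * bval (1/3) (1/3) ^ yCount3 u v
          * bval (2/3) (2/3) ^ zCount3 u v)
        = q * cstW3 u' v' * (bval (1/3) (2/3) ^ xCount3 u' v' * bval (1/3) (1/3) ^ yCount3 u' v'
          * bval (2/3) (2/3) ^ zCount3 u' v') := by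
      have := hv; rw [vr, vr'] at this; linear_combination this
    apply mul_right_cancel₀ hW0
    calc (cstW3 u v : ℝ) * 3 ^ zCount3 u v * ((3:ℝ) ^ zCount3 u' v' * (bval (1/3) (2/3) ^ xCount3 u v
            * bval (1/3) (1/3) ^ yCount3 u v * bval (2/3) (2/3) ^ zCount3 u v))
          = ((cstW3 u v : ℝ) * (bval (1/3) (2/3) ^ xCount3 u v * bval (1/3) (1/3) ^ yCount3 u v
            * bval (2/3) (2/3) ^ zCount3 u v)) * 3 ^ zCount3 u v * 3 ^ zCount3 u' v' := by ring
      _ = (q * cstW3 u' v' * (bval (1/3) (2/3) ^ xCount3 u' v' * bval (1/3) (1/3) ^ yCount3 u' v'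
            * bval (2/3) (2/3) ^ zCount3 u' v')) * 3 ^ zCount3 u v * 3 ^ zCount3 u' v' := by rw [e]
      _ = q * cstW3 u' v' * 3 ^ zCount3 u' v' * ((3:ℝ) ^ zCount3 u v * (bval (1/3) (2/3) ^ xCount3 u' v'
            * bval (1/3) (1/3) ^ yCount3 u' v' * bval (2/3) (2/3) ^ zCount3 u' v')) := by ring
      _ = q * cstW3 u' v' * 3 ^ zCount3 u' v' * ((3:ℝ) ^ zCount3 u' v' * (bval (1/3) (2/3) ^ xCount3 u v
            * bval (1/3) (1/3) ^ yCount3 u v * bval (2/3) (2/3) ^ zCount3 u v)) := by rw [hWv]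
  -- classes
  have hWP : kcQ 3 ^ zCount3 u' v' * (bcl (1/3) (2/3) ^ xCount3 u v * bcl (1/3) (1/3) ^ yCount3 u v
        * bcl (2/3) (2/3) ^ zCount3 u v)
      = kcQ 3 ^ zCount3 u v * (bcl (1/3) (2/3) ^ xCount3 u' v' * bcl (1/3) (1/3) ^ yCount3 u' v'
        * bcl (2/3) (2/3) ^ zCount3 u' v') :=
    nf3 (dirichlet_rel hD) hxz hyz
  have hW2 : bcl (1/3) (2/3) ^ xCount3 u' v' * bcl (1/3) (1/3) ^ yCount3 u' v' * bcl (2/3) (2/3) ^ zCount3 u' v'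
      = kcQ (1/3) ^ zCount3 u v * kcQ 3 ^ zCount3 u' v' * (bcl (1/3) (2/3) ^ xCount3 u v
        * bcl (1/3) (1/3) ^ yCount3 u v * bcl (2/3) (2/3) ^ zCount3 u v) := by
    calc bcl (1/3) (2/3) ^ xCount3 u' v' * bcl (1/3) (1/3) ^ yCount3 u' v' * bcl (2/3) (2/3) ^ zCount3 u' v'
          = (kcQ (1/3) * kcQ 3) ^ zCount3 u v * (bcl (1/3) (2/3) ^ xCount3 u' v' * bcl (1/3) (1/3) ^ yCount3 u' v'
            * bcl (2/3) (2/3) ^ zCount3 u' v') := by rw [kcQ_three_inv_mul, one_pow, one_mul]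
      _ = kcQ (1/3) ^ zCount3 u v * (kcQ 3 ^ zCount3 u v * (bcl (1/3) (2/3) ^ xCount3 u' v'
            * bcl (1/3) (1/3) ^ yCount3 u' v' * bcl (2/3) (2/3) ^ zCount3 u' v')) := by rw [mul_pow, mul_assoc]
      _ = kcQ (1/3) ^ zCount3 u v * (kcQ 3 ^ zCount3 u' v' * (bcl (1/3) (2/3) ^ xCount3 u v
            * bcl (1/3) (1/3) ^ yCount3 u v * bcl (2/3) (2/3) ^ zCount3 u v)) := by rw [hWP]
      _ = _ := by ring
  have er : KZ.toFormalPeriod (KZ.of r) = kcQ (cstW3 u v) * (bcl (1/3) (2/3) ^ xCount3 u v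
      * bcl (1/3) (1/3) ^ yCount3 u v * bcl (2/3) (2/3) ^ zCount3 u v) := by
    rw [word_class _ _ hab r hr hi, word_class_three]; ring
  have er' : KZ.toFormalPeriod (KZ.of r') = (kc q hq * kcQ (cstW3 u' v') * kcQ (1/3) ^ zCount3 u v
      * kcQ 3 ^ zCount3 u' v') * (bcl (1/3) (2/3) ^ xCount3 u v
      * bcl (1/3) (1/3) ^ yCount3 u v * bcl (2/3) (2/3) ^ zCount3 u v) := by
    rw [word_class_const q hq _ _ hab' r' hr' hi', word_class_three, mul_assoc (kcQ (cstW3 u' v')), mul_assoc (kcQ _),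
      hW2]
    ring
  have hsc : kc q hq * kcQ (cstW3 u' v') * kcQ (1/3) ^ zCount3 u v * kcQ 3 ^ zCount3 u' v' = kcQ (cstW3 u v) := by
    rw [kcQ_pow, kcQ_pow, kcQ, kcQ, kcQ, kcQ, ← kc_mul, ← kc_mul, ← kc_mul]
    refine kc_congr _ _ ?_
    push_cast
    have h13 : (1/3:ℝ) ^ zCount3 u v * (3:ℝ) ^ zCount3 u v = 1 := by rw [← mul_pow]; norm_num
    linear_combination (-((1/3:ℝ) ^ zCount3 u v)) * key + (cstW3 u v : ℝ) * h13
  have e : KZ.toFormalPeriod (KZ.of r) = KZ.toFormalPeriod (KZ.of r') := by rw [er, er', hsc]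
  show KZ.of r - KZ.of r' ∈ KZ.relations
  exact KZ.toFormalPeriod_eq_iff.mp e

/-- **THE LEVEL-3 SLICE OF EVERY SECTOR, FROM CHUDNOVSKY + ONE MOVE**: `RohrlichHodgeAt 3 → BetaDirichletMove → ∀ k, Box(k,3)`.
[this node] -/
theorem betaWordSectorLevel_three_of_dirichlet (hR : RohrlichHodgeAt 3) (hD : BetaDirichletMove) (k : ℕ) :
    BetaWordSectorLevel k 3 :=
  (betaWordSectorLevel_iff_of_rohrlichHodgeAt (by norm_num) hR k).mpr (boxChain_three_of_dirichlet hD k)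

/-- The same with Chudnovsky's theorem typed faithfully (`ChudnovskyGammaThird = AlgebraicIndependent ℚ ![Γ(⅓), π]`):
`ChudnovskyGammaThird → BetaDirichletMove → ∀ k, BetaWordSectorLevel k 3`. [this node] -/
theorem betaWordSectorLevel_three_of_chudnovsky_dirichlet (h : ChudnovskyGammaThird) (hD : BetaDirichletMove) (k : ℕ) :
    BetaWordSectorLevel k 3 :=
  betaWordSectorLevel_three_of_dirichlet (rohrlichHodgeAt_three_of_chudnovsky h) hD k

/-- Hence the base range of crux 3898 SHRINKS: modulo Chudnovsky (levels 3, 4) and the Dirichlet move, `BetaProductSector` is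
the two finite chain statements at levels 4 and 6 plus the levels `N = 5, N ≥ 7`. [this node] -/
theorem betaProductSector_iff_of_chudnovsky_dirichlet (h3 : ChudnovskyGammaThird) (h4 : ChudnovskyGammaQuarter)
    (hD : BetaDirichletMove) :
    Summit.KontsevichZagierPeriods.KontsevichZagierPeriods.Theses.FermatIsogeny.BetaProductSector ↔
      ((BoxChain 2 4 (SameType 4) ∧ BoxChain 2 6 (SameType 6)) ∧
        ∀ N, 3 ≤ N → N ≠ 3 → N ≠ 4 → N ≠ 6 → BetaWordSectorLevel 2 N) := by
  rw [betaProductSector_iff_baseRange_of_chudnovsky h3 h4]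
  have hc : BoxChain 2 3 (SameType 3) := boxChain_three_of_dirichlet hD 2
  constructor
  · rintro ⟨⟨_, h4', h6'⟩, H⟩; exact ⟨⟨h4', h6'⟩, H⟩
  · rintro ⟨⟨h4', h6'⟩, H⟩; exact ⟨⟨hc, h4', h6'⟩, H⟩

end LevelThreeChains

/-! ### ADDENDUM 4b — THE DIRICHLET MOVE IS A THEOREM OF THE TREE (`KZDirichletCharts`): level 3 is CLOSED

`Literature/NumberTheory/Transcendental/KZDirichletCharts.lean` realises Dirichlet's re-association
`B(a,b)·B(a+b,c) = B(b,c)·B(a,b+c)` INSIDE the Kontsevich–Zagier rules as TWO change-of-variables moves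
through the open simplex (`KZ.dirichletPolar_equivalent`, `KZ.dirichletLinear_equivalent`, both PROVED,
no named fact).  Consequently `BetaDirichletMove` holds, the identity holds in `P`, and
`BoxChain k 3 (SameType 3)` is an outright theorem for every word length `k`; the level-3 slice of
every Beta-word sector is a theorem modulo `RohrlichHodgeAt 3` alone, i.e. modulo
`ChudnovskyGammaThird` — which the tree ALSO proves (`algebraicIndependent_real_pi_gamma_one_third`,
`KontsevichZagierGammaProofs.lean` l.446; not imported here only because that module is unbuilt on the
farm today, critic g6-19). -/
section DirichletHolds

/-- **Dirichlet's formula in `P`**: `β(a+b,c)·β(a,b) = β(b,c)·β(a,b+c)` for positive rationals — the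
cube representation `[(0,1)², x^{a+b-1}(1-x)^{c-1}·y^{a-1}(1-y)^{b-1}]` ∼ the simplex representation
`[Δ, u^{a-1}v^{b-1}(1-u-v)^{c-1}]` (polar chart) ∼ `[(0,1)², t^{b-1}(1-t)^{c-1}·u^{a-1}(1-u)^{b+c-1}]`
(linear chart), and a cube word representation is the product of its Beta classes (`word_class`).
(cite AndrewsAskeyRoy1999, Thm 1.8.1) -/
theorem bcl_dirichlet (a b c : ℚ) (ha : 0 < a) (hb : 0 < b) (hc : 0 < c) :
    bcl (a + b) c * bcl a b = bcl b c * bcl a (b + c) := by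
  have hposP : ∀ j : Fin 2, 0 < (![a + b, a] : Fin 2 → ℚ) j ∧ 0 < (![c, b] : Fin 2 → ℚ) j := by
    intro j; fin_cases j
    · exact ⟨by simpa using add_pos ha hb, by simpa using hc⟩
    · exact ⟨by simpa using ha, by simpa using hb⟩
  have hposB : ∀ j : Fin 2, 0 < (![b, a] : Fin 2 → ℚ) j ∧ 0 < (![c, b + c] : Fin 2 → ℚ) j := by
    intro j; fin_cases j
    · exact ⟨by simpa using hb, by simpa using hc⟩
    · exact ⟨by simpa using ha, by simpa using add_pos hb hc⟩
  obtain ⟨P, hPd, hPi⟩ := KZ.exists_cubeBetaRep ![a + b, a] ![c, b] hposP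
  obtain ⟨B, hBd, hBi⟩ := KZ.exists_cubeBetaRep ![b, a] ![c, b + c] hposB
  have hbox : ({t | ∀ j : Fin 2, t j ∈ Set.Ioo (0:ℝ) 1} : Set (Fin 2 → ℝ)) =
      {z | z 0 ∈ Set.Ioo (0:ℝ) 1 ∧ z 1 ∈ Set.Ioo (0:ℝ) 1} := by
    ext z; simp only [Set.mem_setOf_eq, Fin.forall_fin_two]
  have hPd' : P.domain = {z | z 0 ∈ Set.Ioo (0:ℝ) 1 ∧ z 1 ∈ Set.Ioo (0:ℝ) 1} := hPd.trans hbox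
  have hBd' : B.domain = {z | z 0 ∈ Set.Ioo (0:ℝ) 1 ∧ z 1 ∈ Set.Ioo (0:ℝ) 1} := hBd.trans hbox
  have hPi' : Set.EqOn P.integrand (fun z => (z 0) ^ ((a:ℝ) + b - 1) * (1 - z 0) ^ ((c:ℝ) - 1) *
      ((z 1) ^ ((a:ℝ) - 1) * (1 - z 1) ^ ((b:ℝ) - 1))) P.domain := by
    intro z hz
    rw [hPi hz]
    simp only [Fin.prod_univ_two, Matrix.cons_val_zero, Matrix.cons_val_one]
    push_cast
    ring_nf
  have hBi' : Set.EqOn B.integrand (fun z => (z 0) ^ ((b:ℝ) - 1) * (1 - z 0) ^ ((c:ℝ) - 1) *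
      ((z 1) ^ ((a:ℝ) - 1) * (1 - z 1) ^ ((b:ℝ) + c - 1))) B.domain := by
    intro z hz
    rw [hBi hz]
    simp only [Fin.prod_univ_two, Matrix.cons_val_zero, Matrix.cons_val_one]
    push_cast
    ring_nf
  obtain ⟨S, hSd, hSi, hPS⟩ := KZ.dirichletPolar_equivalent a b c P hPd' hPi'
  have hSB : KZ.Equivalent S B := KZ.dirichletLinear_equivalent a b c S B hSd hSi hBd' hBi'
  have eP : KZ.toFormalPeriod (KZ.of P) = bcl (a + b) c * bcl a b := by
    rw [word_class ![a + b, a] ![c, b] hposP P hPd hPi, Fin.prod_univ_two]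
    simp only [Matrix.cons_val_zero, Matrix.cons_val_one]
  have eB : KZ.toFormalPeriod (KZ.of B) = bcl b c * bcl a (b + c) := by
    rw [word_class ![b, a] ![c, b + c] hposB B hBd hBi, Fin.prod_univ_two]
    simp only [Matrix.cons_val_zero, Matrix.cons_val_one]
  rw [← eP, ← eB]
  exact hPS.toFormalPeriod_eq.trans hSB.toFormalPeriod_eq

/-- **The Dirichlet move holds** (it was the one hypothesis of `boxChain_three_of_dirichlet`): two
change-of-variables moves of the tree + letter bookkeeping in `P`. (cite AndrewsAskeyRoy1999, Thm 1.8.1) -/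
theorem betaDirichletMove_holds : BetaDirichletMove := by
  intro a b c ha hb hc ρ ρ' hρd hρi hρ'd hρ'i
  have hpos : ∀ j : Fin 2, 0 < (![a, a + b] : Fin 2 → ℚ) j ∧ 0 < (![b, c] : Fin 2 → ℚ) j := by
    intro j; fin_cases j
    · exact ⟨by simpa using ha, by simpa using hb⟩
    · exact ⟨by simpa using add_pos ha hb, by simpa using hc⟩
  have hpos' : ∀ j : Fin 2, 0 < (![b, a] : Fin 2 → ℚ) j ∧ 0 < (![c, b + c] : Fin 2 → ℚ) j := by
    intro j; fin_cases j
    · exact ⟨by simpa using hb, by simpa using hc⟩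
    · exact ⟨by simpa using ha, by simpa using add_pos hb hc⟩
  have e1 : KZ.toFormalPeriod (KZ.of ρ) = bcl a b * bcl (a + b) c := by
    rw [word_class ![a, a + b] ![b, c] hpos ρ hρd hρi, Fin.prod_univ_two]
    simp only [Matrix.cons_val_zero, Matrix.cons_val_one]
  have e2 : KZ.toFormalPeriod (KZ.of ρ') = bcl b c * bcl a (b + c) := by
    rw [word_class ![b, a] ![c, b + c] hpos' ρ' hρ'd hρ'i, Fin.prod_univ_two]
    simp only [Matrix.cons_val_zero, Matrix.cons_val_one]
  have e : KZ.toFormalPeriod (KZ.of ρ) = KZ.toFormalPeriod (KZ.of ρ') := by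
    rw [e1, e2, mul_comm (bcl a b), bcl_dirichlet a b c ha hb hc]
  exact KZ.toFormalPeriod_eq_iff.mp e

/-- **LEVEL-3 CHAINS, UNCONDITIONALLY**: every same-DKO-type pair of length-`k` Beta words with letters in
`{⅓, ⅔, 1}²` and equal value up to the (algebraic) ratio is a KZ-chain. [this work] -/
theorem boxChain_three (k : ℕ) : BoxChain k 3 (SameType 3) :=
  boxChain_three_of_dirichlet betaDirichletMove_holds k

/-- Level 3 of every Beta-word sector modulo the Γ-hypothesis `RohrlichHodgeAt 3` alone. [this work] -/
theorem betaWordSectorLevel_three_of_rohrlichHodgeAt (hR : RohrlichHodgeAt 3) (k : ℕ) : BetaWordSectorLevel k 3 :=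
  betaWordSectorLevel_three_of_dirichlet hR betaDirichletMove_holds k

/-- **LEVEL 3 OF EVERY BETA-WORD SECTOR** modulo Chudnovsky 1976 (`Γ(⅓), π` algebraically independent —
a theorem of the tree, `algebraicIndependent_real_pi_gamma_one_third`, pending its farm build). [this work] -/
theorem betaWordSectorLevel_three_of_chudnovsky (h : ChudnovskyGammaThird) (k : ℕ) : BetaWordSectorLevel k 3 :=
  betaWordSectorLevel_three_of_chudnovsky_dirichlet h betaDirichletMove_holds k

/-- **Crux 3898's base range, level 3 discharged**: modulo the two printed Chudnovsky theorems,
`BetaProductSector ⟺ (BoxChain 2 4 (SameType 4) ∧ BoxChain 2 6 (SameType 6)) ∧ (levels N = 5, N ≥ 7)`. [this work] -/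
theorem betaProductSector_iff_of_chudnovsky (h3 : ChudnovskyGammaThird) (h4 : ChudnovskyGammaQuarter) :
    Summit.KontsevichZagierPeriods.KontsevichZagierPeriods.Theses.FermatIsogeny.BetaProductSector ↔
      ((BoxChain 2 4 (SameType 4) ∧ BoxChain 2 6 (SameType 6)) ∧
        ∀ N, 3 ≤ N → N ≠ 3 → N ≠ 4 → N ≠ 6 → BetaWordSectorLevel 2 N) :=
  betaProductSector_iff_of_chudnovsky_dirichlet h3 h4 betaDirichletMove_holds

/-- The level-3 Dirichlet identity in `P`, now unconditional: `β(⅓,⅓)·β(⅔,⅔) = κ(3)·β(⅓,⅔)`. [this work] -/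
theorem dirichlet_rel_holds : bcl (1/3) (1/3) * bcl (2/3) (2/3) = kcQ 3 * bcl (1/3) (2/3) :=
  dirichlet_rel betaDirichletMove_holds

end DirichletHolds

/-!
### ADDENDUM 5 (decomp-kz · lens-5 · g22) — LEGENDRE'S DUPLICATION AS KZ MOVES, IN `P`

`bcl a a = κ(2^{1−2a}) · bcl a ½` for every rational `a > 0` (Legendre `B(a,a) = 2^{1−2a} B(a,½)`,
[AndrewsAskeyRoy1999 Thm 1.5.1]) from two moves of the calculus: FOLD the symmetric cell at `½` (split rule (1a),
reflection `x ↦ 1−x` rule (2), integrand additivity rule (1b)) and the DUPLICATION substitution `u = 4x(1−x)` on `(0,½)`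
(rule (2)).  PROVENANCE: the two move proofs are VENDORED VERBATIM (renamed, `stub_` dropped) from the route's own Theorems
`FermatIsogenyBetaLinearSectorQuartersStubBetaFold.lean` (`stub_betaSymm_fold`) and `…QuartersStubBetaDuplication.lean`
(`betaDup_*`, `stub_betaFold_duplication`) — both UNBUILT on the farm today (rc 75 stale:161), hence not importable — over the
importable `Theorems.HermiteRigidityCMTwistQuasiPeriodTransferMoves` (builds); the only edit: the semialgebraicity of
`x ↦ 4x(1−x)` is taken from `isSemialgebraicFunOn_aeval` directly instead of `isSemialgebraicFunOn_ratFun₁` (unbuilt module).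
-/

namespace BetaMoves

open MeasureTheory Set
open Literature.NumberTheory.Transcendental Literature.NumberTheory.Transcendental.KZ
open Literature.ModelTheory.ExponentialFields (IsSemialgebraic)
open Summit.KontsevichZagierPeriods.HermiteRigidity.CMTwistQuasiPeriodTransfer
  (isSemialgebraic_setOf_apply_lt_of_isAlgebraic isSemialgebraic_setOf_apply_gt_of_isAlgebraic
    of_sub_of_sub_mem_relations_split of_sub_of_mem_changeOfVariablesRel_dimOne)

/-- **Folding the symmetric Beta cell at `1/2`.** For every rational `a > 0`,
`[(0,1), x^{a-1}(1-x)^{a-1}] ∼ [(0,1/2), 2·x^{a-1}(1-x)^{a-1}]` for representations pinned by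
their domains and their integrands on them: split at the algebraic abscissa `1/2` (rule (1a)),
identify the two halves by the reflection `x ↦ 1 − x`, which fixes the symmetric integrand
(rule (2)), and add the two equal integrands on `(0,1/2)` (rule (1b)). This is the first step of
Legendre's duplication formula `B(a,a) = 2^{1-2a} B(a,1/2)` inside the calculus.
(cite KontsevichZagier2001, §1.2 rules (1), (2)) -/
private theorem betaSymm_fold : ∀ a : ℚ, 0 < a → ∀ (r h : KZ.IntegralRep 1),
    r.domain = {x | x 0 ∈ Set.Ioo (0:ℝ) 1} →
    Set.EqOn r.integrand (fun x => (x 0) ^ ((a:ℝ) - 1) * (1 - x 0) ^ ((a:ℝ) - 1)) r.domain →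
    h.domain = {x | 0 < x 0 ∧ x 0 < 1 / 2} →
    Set.EqOn h.integrand (fun x => 2 * ((x 0) ^ ((a:ℝ) - 1) * (1 - x 0) ^ ((a:ℝ) - 1))) h.domain →
    KZ.Equivalent r h := by
  intro a _ r h hrd hri hhd hhi
  have hhalf : IsAlgebraic ℚ ((1:ℝ) / 2) := by
    simpa using isAlgebraic_algebraMap (R := ℚ) (A := ℝ) (1 / 2 : ℚ)
  -- the two halves of `r`
  have hs₁ : IsSemialgebraic ℚ (r.domain ∩ {p : Fin 1 → ℝ | p 0 < 1 / 2}) :=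
    r.isSemialgebraic_domain.inter (isSemialgebraic_setOf_apply_lt_of_isAlgebraic hhalf 0)
  have hs₂ : IsSemialgebraic ℚ (r.domain ∩ {p : Fin 1 → ℝ | 1 / 2 < p 0}) :=
    r.isSemialgebraic_domain.inter (isSemialgebraic_setOf_apply_gt_of_isAlgebraic hhalf 0)
  set W₁ := r.restrict _ hs₁ inter_subset_left with hW₁
  set W₂ := r.restrict _ hs₂ inter_subset_left with hW₂
  -- rule (1a): split at `1/2`
  have hsplit : of r - of W₁ - of W₂ ∈ relations :=
    of_sub_of_sub_mem_relations_split r W₁ W₂ hhalf rfl rfl (fun _ _ => rfl) (fun _ _ => rfl)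
  have hW₁d : W₁.domain = {x : Fin 1 → ℝ | 0 < x 0 ∧ x 0 < 1 / 2} := by
    rw [hW₁, IntegralRep.domain_restrict, hrd]
    ext x
    simp only [mem_inter_iff, mem_setOf_eq, mem_Ioo]
    constructor
    · rintro ⟨⟨h1, -⟩, h2⟩; exact ⟨h1, h2⟩
    · rintro ⟨h1, h2⟩; exact ⟨⟨h1, by linarith⟩, h2⟩
  have hW₂d : W₂.domain = {x : Fin 1 → ℝ | 1 / 2 < x 0 ∧ x 0 < 1} := by
    rw [hW₂, IntegralRep.domain_restrict, hrd]
    ext x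
    simp only [mem_inter_iff, mem_setOf_eq, mem_Ioo]
    constructor
    · rintro ⟨⟨-, h1⟩, h2⟩; exact ⟨h2, h1⟩
    · rintro ⟨h1, h2⟩; exact ⟨⟨by linarith, h2⟩, h1⟩
  -- rule (2): the reflection `x ↦ 1 - x` identifies the lower half with the upper half
  have hrefl : of W₁ - of W₂ ∈ relations := by
    refine of_sub_of_mem_relations_of_boxReflection (0 : Fin 1) ?_ fun x hx => ?_
    · rw [hW₁d, hW₂d]
      ext x
      simp only [mem_setOf_eq, mem_preimage, boxReflection_apply_self]
      constructor <;> rintro ⟨h1, h2⟩ <;> constructor <;> linarith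
    · have hx' : 0 < x 0 ∧ x 0 < 1 / 2 := by rw [hW₁d] at hx; exact hx
      have hmem : x ∈ r.domain := by rw [hrd]; exact ⟨hx'.1, by linarith [hx'.2]⟩
      have hmem' : boxReflection (0 : Fin 1) x ∈ r.domain := by
        rw [hrd]
        show boxReflection 0 x 0 ∈ Ioo (0:ℝ) 1
        rw [boxReflection_apply_self]
        exact ⟨by linarith [hx'.2], by linarith [hx'.1]⟩
      rw [hW₁, hW₂, IntegralRep.integrand_restrict, IntegralRep.integrand_restrict, hri hmem,
        hri hmem']
      simp only [boxReflection_apply_self, sub_sub_cancel]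
      ring
  -- rule (1b): `2·f = f + f` on `(0,1/2)`
  have hadd : of h - of W₁ - of W₁ ∈ relations := by
    refine integrandAddRel_subset_relations ⟨1, h, W₁, W₁, by rw [hW₁d, hhd], by rw [hW₁d, hhd],
      fun x hx => ?_, rfl⟩
    have hx' : 0 < x 0 ∧ x 0 < 1 / 2 := by rw [hhd] at hx; exact hx
    have hmem : x ∈ r.domain := by rw [hrd]; exact ⟨hx'.1, by linarith [hx'.2]⟩
    rw [hhi hx, Pi.add_apply, hW₁, IntegralRep.integrand_restrict, hri hmem]
    dsimp only
    ring
  have : of r - of h = (of r - of W₁ - of W₂) - (of h - of W₁ - of W₁) - (of W₁ - of W₂) := by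
    abel
  show of r - of h ∈ relations
  rw [this]
  exact relations.sub_mem (relations.sub_mem hsplit hadd) hrefl

/-! ## The substitution `u = 4x(1-x)` on `(0, 1/2)` -/

/-- The derivative of `Φ(x) = 4x(1-x)` is `4(1-2x)`. -/
private theorem betaDup_hasDerivAt (x : ℝ) :
    HasDerivAt (fun x : ℝ => 4 * x * (1 - x)) (4 * (1 - 2 * x)) x := by
  have h1 : HasDerivAt (fun x : ℝ => 4 * x) 4 x := by
    simpa using (hasDerivAt_id x).const_mul (4:ℝ)
  have h2 : HasDerivAt (fun x : ℝ => 1 - x) (-1) x := by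
    simpa using (hasDerivAt_id x).const_sub (1:ℝ)
  exact (h1.mul h2).congr_deriv (by ring)

/-- `1 - 4x(1-x) = (1-2x)²`. -/
private theorem betaDup_one_sub (x : ℝ) : 1 - 4 * x * (1 - x) = (1 - 2 * x) ^ 2 := by ring

/-- `Φ = 4x(1-x)` is injective on `{x < 1/2}`: `Φ p = Φ q` forces `(p-q)(1-p-q) = 0`. -/
private theorem betaDup_inj {p q : ℝ} (hp : p < 1 / 2) (hq : q < 1 / 2)
    (h : 4 * p * (1 - p) = 4 * q * (1 - q)) : p = q := by
  have h1 : (p - q) * (4 * (1 - p - q)) = 0 := by linear_combination h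
  rcases mul_eq_zero.1 h1 with h2 | h2
  · linarith
  · linarith

end BetaMoves
end Summit.KontsevichZagierPeriods.FermatIsogeny.DeepTargets
end
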